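import Summits.QuantumFields.BalabanUV.Beta.FP.PerfectTelescopingFiniteUnits
import Summits.QuantumFields.BalabanUV.Beta.FP.StationarityK
import Mathlib.Analysis.Normed.Group.Tannery

/-!
# `BalabanUV.Beta.FP.PerfectTelescopingLimit` — road «FP» for binder row D1, leaf N7 ∕ (MS-1), K-side, TRANSVERSE form, AT THE LIMIT `j → ∞`
# UNDER NAMED CONVERGENCE ∕ UNIFORM-DECAY ROWS: `⟨G, Γ^perf_{m+1} G′⟩ = ⟨G, Γ^perf_m G′⟩ − (Lc^m)^{−2}·⟨G, [KPerf m ∘ liftW (Lc^m) tt (KPerf 1) ∘ KPerf m]_ff G′⟩`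

HONEST FRAMING (cell contract, verbatim): «discharging `BetaPertH` makes Bałaban's UV stability UNCONDITIONAL — a real constructive-QFT
result; it is NOT the continuum limit and NOT the Clay problem.»  HONEST DEPENDENCY (verbatim): «continuum YM on T⁴ ⇐ BetaPertH ∧ nine
spine estimates (0/9 proved); BetaPertH ⇐ (D1) ∧ (D4) ∧ CAP+tail; G-an2-4 gates asym, D1 and NE2/3/4.»  THIS MODULE DISCHARGES NOTHING of
the wall: it passes the finite-level identity `PerfectTelescopingFiniteUnits.kTot_pair_telescoping_adopted` to the limit `j → ∞` by the
discrete dominated-convergence theorem (Mathlib `tendsto_tsum_of_dominated_convergence`, twice — the composite is a double coarse series)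
UNDER HYPOTHESES that are displayed, asserted nowhere: entrywise convergence of the unit-rescaled (j, m+1)-, (j, m)- and one-step families
(the X1m ∕ (CONV-C)-class rows of `LEAVES-FP.md`, row G-an2-4's currency) and a `j`-uniform `Decays` ∕ bound of the rescaled (j, m)- and
one-step families (the road's «class data» rows).  No `def`, no `Prop` minted, nothing cited, 0 sorry.  0 wall binders; NOT `hasym`, NOT X1m,
NOT D1, NOT `BetaPertH`, NOT continuum, NOT Clay.

ABSOLUTE RULE (cell charter, verbatim): «No internally-minted statement may enter as a cited fact. Every hypothesis is either kernel-proved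
in this package or a verbatim quotation of a PUBLISHED theorem with page reference. The manuscript(s) under audit are NOT citable for their
own disputed steps — they are the thing under adjudication; programme-internal (2001/route/tribunal) claims are never citable.»

WHY (road FP owner d1-p3's N7 PLAN v1 §2 (MS-1) «Lean shape: an equality of `MKer 4 (Fib 3)` ff-blocks between `KPerfOf … (m+1)`, `KPerfOf … m`,
`colOf`, and `KPerfOf … 1` … SUPPLIERS: the finite-j two-level resolvent identities …, stationarity N1, entrywise limits»; sub-row MS-1-FIN).
In the axial slice the entrywise shape is not available (an5's `K1aNeg` false for `j ≥ 1`; owner's F-d1p3-g3-1); the TRANSVERSE shape is, and this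
file delivers it at the perfect objects `KPerf Lc sf sm m = limMKerOf (j ↦ unitK (sf j) (sm j) (KTot (Lc^(j+m)) (Lc^j)))` (`FP/PerfectObjectsT`) in
the adopted units `sf j = Lc^j`, `sm j = Lc^{j(d+1)}`, the one-step factor being `KPerf … 1` (index shift `StationarityK.limMKerOf_add`).

VERSIONS.  v1 = p229591.  v1.1 (this file): proof-only — two unused `have`s removed from `tendsto_comp_liftW_comp` (XREAD C-ne9leaf05g22-1 DOCFIX-LOW); every
statement byte-identical.

CONTENT (all [folklore]; general `d`, `Lc ≥ 1`).
* §1 `summable_exp_dilate` (`w′ ↦ e^{−δ|P•w′ − y|₁}` is summable), `tendsto_limMKerOf_apply` (a convergent entry converges to the constructed limit),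
  **`tendsto_comp_liftW_comp`** (GENERIC: the lifted composite `[B_j ∘ liftW P tt S_j ∘ B_j]_ff` converges entrywise to that of the entrywise
  limits, for `B_j` uniformly decaying and entrywise convergent and `S_j` uniformly bounded and entrywise convergent on its ff block — Tannery twice).
* §2 **`kPerf_pair_telescoping`** — (MS-1) at the limit, K-side, transverse, under the displayed rows.
Unit `b2b-balaban-gan24-formalise-leaf-05` (gen 33; cross-lane idle G-an2-4 swarm leaf seat on road FP's sub-row MS-1-FIN).
-/

noncomputable section

namespace Summit.QuantumFields.BalabanUV.Beta.FP.PerfectTelescopingLimit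

open Finset Filter Topology
open scoped BigOperators
open Literature.MathematicalPhysics.QuantumFieldTheory.Balaban1983to89
open Literature.MathematicalPhysics.QuantumFieldTheory.Balaban1983to89.Beta
open B12Sec2to5 (l1 l1_nonneg)
open AffineAveraging (Form1 codiff₁)
open ExpKernelCalculus (MKer Decays comp summable_exp_shift summable_exp_shift')
open OneStepResolventKernel (Fib KInv)
open OneStepKernelFamily (dec KInvStep)
open InterLevelTransport (liftW slotW slotW_true slotW_nonneg)
open ResolventComposition (slot_true)
open ResolventCompositionStepB (tsum_pair_eq_sum exists_support_finset)
open Literature.MathematicalPhysics.QuantumFieldTheory.LatticeForm (quo)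
open HessKerDressedLimit (limMKerOf limMKerOf_apply)
open Summit.QuantumFields.BalabanUV.Beta.HessKerDressedUnits (unitK)
open Summit.QuantumFields.BalabanUV.Beta.FP.PerfectObjects (KTot KInvStep_eq_KTot)
open Summit.QuantumFields.BalabanUV.Beta.FP.PerfectObjectsT (KPerf KPerf_one)
open Summit.QuantumFields.BalabanUV.Beta.FP.StationarityK (limMKerOf_add)
open Summit.QuantumFields.BalabanUV.Beta.FP.PerfectTelescopingFiniteComposite (comp_liftW_comp_apply)
open Summit.QuantumFields.BalabanUV.Beta.FP.PerfectTelescopingFiniteUnits (kTot_pair_telescoping_adopted)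

variable {d : ℕ}

/-! ## §1 Dominated convergence for the lifted composite -/

/-- [folklore] The dilated exponential profile is summable: `Σ_{w′} e^{−δ|P•w′ − y|₁} < ∞` (`P ≥ 1`, `δ > 0`; a subseries of `summable_exp_shift′`). -/
theorem summable_exp_dilate (P : ℕ) [NeZero P] {δ : ℝ} (hδ : 0 < δ) (y : Fin (d + 1) → ℤ) :
    Summable fun w' : Fin (d + 1) → ℤ => Real.exp (-δ * l1 ((P : ℤ) • w' - y)) := by
  have hi : Function.Injective fun w' : Fin (d + 1) → ℤ => (P : ℤ) • w' := by
    intro a b hab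
    have h := congrArg (quo P) hab
    simpa only [OneStepResolventKernel.quo_zsmul] using h
  exact (summable_exp_shift' hδ y).comp_injective hi

/-- [folklore] A convergent entry converges to the CONSTRUCTED limit `limMKerOf` (= `limUnder atTop` entry by entry). -/
theorem tendsto_limMKerOf_apply {F : Type*} {K : ℕ → MKer (d + 1) F} (x y : Fin (d + 1) → ℤ) (a b : F)
    (h : ∃ L, Tendsto (fun j => K j x y a b) atTop (𝓝 L)) :
    Tendsto (fun j => K j x y a b) atTop (𝓝 (limMKerOf K x y a b)) := by
  rw [limMKerOf_apply]
  exact tendsto_nhds_limUnder h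

/-- [folklore] **DOMINATED CONVERGENCE FOR THE LIFTED COMPOSITE** (generic).  If `B_j → B∞` entrywise with a `j`-UNIFORM decay `Decays (B j) CB δB`
(`δB > 0`), and the field–field block of `S_j` converges entrywise to that of `S∞` with a `j`-uniform bound `CS`, then every field–field entry of
`B_j ∘ liftW P true true S_j ∘ B_j` converges to that of `B∞ ∘ liftW P true true S∞ ∘ B∞` (`comp_liftW_comp_apply` + Tannery's theorem twice). -/
theorem tendsto_comp_liftW_comp (P : ℕ) [NeZero P] {B S : ℕ → MKer (d + 1) (Fib d)} {Binf Sinf : MKer (d + 1) (Fib d)} {CB δB CS : ℝ}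
    (hB : ∀ x y a b, Tendsto (fun j => B j x y a b) atTop (𝓝 (Binf x y a b)))
    (hS : ∀ z w (μ ν : Fin (d + 1)), Tendsto (fun j => S j z w (Sum.inl μ) (Sum.inl ν)) atTop (𝓝 (Sinf z w (Sum.inl μ) (Sum.inl ν))))
    (hBd : ∀ j, Decays (B j) CB δB) (hδB : 0 < δB) (hSb : ∀ j z w (μ ν : Fin (d + 1)), |S j z w (Sum.inl μ) (Sum.inl ν)| ≤ CS)
    (x y : Fin (d + 1) → ℤ) (κ l : Fin (d + 1)) :
    Tendsto (fun j => comp (B j) (comp (liftW P true true (S j)) (B j)) x y (Sum.inl κ) (Sum.inl l)) atTop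
      (𝓝 (comp Binf (comp (liftW P true true Sinf) Binf) x y (Sum.inl κ) (Sum.inl l))) := by
  have hCB : 0 ≤ CB := (hBd 0).nonneg (Sum.inl 0)
  have hCS : 0 ≤ CS := (abs_nonneg _).trans (hSb 0 0 0 0 0)
  have hW : 0 ≤ slotW d P true * slotW d P true := mul_nonneg (slotW_nonneg d P true) (slotW_nonneg d P true)
  simp only [comp_liftW_comp_apply, slot_true]
  -- the inner series: termwise bound, summable majorant, convergence
  set Z : ℝ := ∑' w' : Fin (d + 1) → ℤ, Real.exp (-δB * l1 ((P : ℤ) • w' - y)) with hZ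
  have hZ0 : 0 ≤ Z := tsum_nonneg fun w' => (Real.exp_pos _).le
  have innerTerm : ∀ (T : MKer (d + 1) (Fib d)) (A : MKer (d + 1) (Fib d)),
      (∀ z w (μ ν : Fin (d + 1)), |T z w (Sum.inl μ) (Sum.inl ν)| ≤ CS) → (∀ x y a b, |A x y a b| ≤ CB * Real.exp (-δB * l1 (x - y))) →
      ∀ (μ : Fin (d + 1)) (z' w' : Fin (d + 1) → ℤ),
        |∑ ν : Fin (d + 1), slotW d P true * slotW d P true * T z' w' (Sum.inl μ) (Sum.inl ν) * A ((P : ℤ) • w') y (Sum.inr ν) (Sum.inl l)|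
          ≤ ((d + 1 : ℕ) : ℝ) * (slotW d P true * slotW d P true * CS * CB) * Real.exp (-δB * l1 ((P : ℤ) • w' - y)) := by
    intro T A hT hA μ z' w'
    refine (Finset.abs_sum_le_sum_abs _ _).trans ?_
    have h1 : ∀ ν ∈ (Finset.univ : Finset (Fin (d + 1))),
        |slotW d P true * slotW d P true * T z' w' (Sum.inl μ) (Sum.inl ν) * A ((P : ℤ) • w') y (Sum.inr ν) (Sum.inl l)|
          ≤ (slotW d P true * slotW d P true * CS * CB) * Real.exp (-δB * l1 ((P : ℤ) • w' - y)) := by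
      intro ν _
      rw [abs_mul, abs_mul, abs_of_nonneg hW]
      calc slotW d P true * slotW d P true * |T z' w' (Sum.inl μ) (Sum.inl ν)| * |A ((P : ℤ) • w') y (Sum.inr ν) (Sum.inl l)|
          ≤ slotW d P true * slotW d P true * CS * (CB * Real.exp (-δB * l1 ((P : ℤ) • w' - y))) :=
            mul_le_mul (mul_le_mul_of_nonneg_left (hT z' w' μ ν) hW) (hA _ _ _ _) (abs_nonneg _)
              (mul_nonneg hW hCS)
        _ = (slotW d P true * slotW d P true * CS * CB) * Real.exp (-δB * l1 ((P : ℤ) • w' - y)) := by ring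
    refine (Finset.sum_le_sum h1).trans (le_of_eq ?_)
    rw [Finset.sum_const, Finset.card_univ, Fintype.card_fin, nsmul_eq_mul]
    ring
  have innerLim : ∀ (μ : Fin (d + 1)) (z' : Fin (d + 1) → ℤ),
      Tendsto (fun j => ∑' w', ∑ ν : Fin (d + 1), slotW d P true * slotW d P true * S j z' w' (Sum.inl μ) (Sum.inl ν)
          * B j ((P : ℤ) • w') y (Sum.inr ν) (Sum.inl l)) atTop
        (𝓝 (∑' w', ∑ ν : Fin (d + 1), slotW d P true * slotW d P true * Sinf z' w' (Sum.inl μ) (Sum.inl ν)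
          * Binf ((P : ℤ) • w') y (Sum.inr ν) (Sum.inl l))) := by
    intro μ z'
    refine tendsto_tsum_of_dominated_convergence
      (bound := fun w' => ((d + 1 : ℕ) : ℝ) * (slotW d P true * slotW d P true * CS * CB) * Real.exp (-δB * l1 ((P : ℤ) • w' - y)))
      ((summable_exp_dilate P hδB y).mul_left _) (fun w' => ?_) (Eventually.of_forall fun j w' => ?_)
    · exact tendsto_finsetSum _ fun ν _ => ((hS z' w' μ ν).const_mul _).mul (hB _ _ _ _)
    · rw [Real.norm_eq_abs]
      exact innerTerm (S j) (B j) (hSb j) (hBd j) μ z' w'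
  -- the inner series is uniformly bounded
  have innerBd : ∀ (T : MKer (d + 1) (Fib d)) (A : MKer (d + 1) (Fib d)),
      (∀ z w (μ ν : Fin (d + 1)), |T z w (Sum.inl μ) (Sum.inl ν)| ≤ CS) → (∀ x y a b, |A x y a b| ≤ CB * Real.exp (-δB * l1 (x - y))) →
      ∀ (μ : Fin (d + 1)) (z' : Fin (d + 1) → ℤ),
        |∑' w', ∑ ν : Fin (d + 1), slotW d P true * slotW d P true * T z' w' (Sum.inl μ) (Sum.inl ν) * A ((P : ℤ) • w') y (Sum.inr ν) (Sum.inl l)|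
          ≤ ((d + 1 : ℕ) : ℝ) * (slotW d P true * slotW d P true * CS * CB) * Z := by
    intro T A hT hA μ z'
    have hs : Summable fun w' : Fin (d + 1) → ℤ =>
        ((d + 1 : ℕ) : ℝ) * (slotW d P true * slotW d P true * CS * CB) * Real.exp (-δB * l1 ((P : ℤ) • w' - y)) :=
      (summable_exp_dilate P hδB y).mul_left _
    have h := tsum_of_norm_bounded hs.hasSum fun w' => by
      rw [Real.norm_eq_abs]; exact innerTerm T A hT hA μ z' w'
    rw [Real.norm_eq_abs] at h
    rwa [tsum_mul_left] at h
  -- the outer series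
  have hi : Function.Injective fun z' : Fin (d + 1) → ℤ => (P : ℤ) • z' := by
    intro a b hab
    have h := congrArg (quo P) hab
    simpa only [OneStepResolventKernel.quo_zsmul] using h
  have hsum : Summable fun z' : Fin (d + 1) → ℤ =>
      (((d + 1 : ℕ) : ℝ) * CB * (((d + 1 : ℕ) : ℝ) * (slotW d P true * slotW d P true * CS * CB) * Z))
        * Real.exp (-δB * l1 (x - (P : ℤ) • z')) :=
    ((summable_exp_shift hδB x).comp_injective hi).mul_left _
  refine tendsto_tsum_of_dominated_convergence
    (bound := fun z' => (((d + 1 : ℕ) : ℝ) * CB * (((d + 1 : ℕ) : ℝ) * (slotW d P true * slotW d P true * CS * CB) * Z))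
        * Real.exp (-δB * l1 (x - (P : ℤ) • z')))
    hsum (fun z' => ?_) (Eventually.of_forall fun j z' => ?_)
  · exact tendsto_finsetSum _ fun μ _ => (hB _ _ _ _).mul (innerLim μ z')
  · rw [Real.norm_eq_abs]
    refine (Finset.abs_sum_le_sum_abs _ _).trans ?_
    have h1 : ∀ μ ∈ (Finset.univ : Finset (Fin (d + 1))),
        |B j x ((P : ℤ) • z') (Sum.inl κ) (Sum.inr μ) * ∑' w', ∑ ν : Fin (d + 1),
            slotW d P true * slotW d P true * S j z' w' (Sum.inl μ) (Sum.inl ν) * B j ((P : ℤ) • w') y (Sum.inr ν) (Sum.inl l)|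
          ≤ CB * Real.exp (-δB * l1 (x - (P : ℤ) • z')) * (((d + 1 : ℕ) : ℝ) * (slotW d P true * slotW d P true * CS * CB) * Z) := by
      intro μ _
      rw [abs_mul]
      exact mul_le_mul (hBd j _ _ _ _) (innerBd (S j) (B j) (hSb j) (hBd j) μ z') (abs_nonneg _) (by positivity)
    refine (Finset.sum_le_sum h1).trans (le_of_eq ?_)
    rw [Finset.sum_const, Finset.card_univ, Fintype.card_fin, nsmul_eq_mul]
    ring

/-! ## §2 (MS-1) at the limit, K-side, transverse form -/

variable (Lc : ℕ) [NeZero Lc]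

/-- [folklore] **(MS-1) AT THE LIMIT, K-SIDE, TRANSVERSE FORM, UNDER NAMED ROWS.**  Adopted units `sf j = Lc^j`, `sm j = Lc^{j(d+1)}`,
`U_j := unitK (sf j) (sm j)`; perfect resolvents `KPerf Lc sf sm m = limMKerOf (j ↦ U_j KTot (Lc^(j+m)) (Lc^j))` (`FP/PerfectObjectsT`).  ASSUME
(displayed, asserted nowhere): (X1m-type rows) every entry of the rescaled (j, m+1)- and (j, m)-families and of the rescaled one-step family
`U_j KInvStep Lc j` converges as `j → ∞`; (class data) the rescaled (j, m)-family decays `j`-uniformly (`Decays (U_j KTot_{j,m}) CB δB`, `δB > 0`) and the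
rescaled one-step family is `j`-uniformly bounded.  THEN, for all finitely supported CO-CLOSED test 1-forms `G, G′`,
`⟨G, [KPerf … (m+1)]_ff G′⟩ = ⟨G, ([KPerf … m] − (Lc^m)^{−2}·[KPerf … m ∘ liftW (Lc^m) true true (KPerf … 1) ∘ KPerf … m])_ff G′⟩` —
«Γ_{Lc^{m+1}} = Γ_{Lc^m} + H_{Lc^m} C^{[Lc^m]} H_{Lc^m}ᵀ, C^{[n]} = n^{−2}·C(·∕n)» on the transverse slice, the N7 PLAN's (MS-1) with `p_C = 2`
(finite level: `PerfectTelescopingFiniteUnits.kTot_pair_telescoping_adopted`; limit: `tendsto_comp_liftW_comp`; one-step factor = `KPerf … 1` by the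
index shift `StationarityK.limMKerOf_add` and `PerfectObjectsT.KPerf_one`). -/
theorem kPerf_pair_telescoping (hLc : 1 ≤ Lc) (m : ℕ) {CB δB CS : ℝ} (hδB : 0 < δB)
    (hconvA : ∀ x y a b, ∃ L, Tendsto (fun j => unitK ((Lc : ℝ) ^ j) ((Lc : ℝ) ^ (j * (d + 1)))
      (KTot (d := d) (Lc ^ (j + m + 1)) (Lc ^ j)) x y a b) atTop (𝓝 L))
    (hconvB : ∀ x y a b, ∃ L, Tendsto (fun j => unitK ((Lc : ℝ) ^ j) ((Lc : ℝ) ^ (j * (d + 1)))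
      (KTot (d := d) (Lc ^ (j + m)) (Lc ^ j)) x y a b) atTop (𝓝 L))
    (hconvC : ∀ x y a b, ∃ L, Tendsto (fun j => unitK ((Lc : ℝ) ^ j) ((Lc : ℝ) ^ (j * (d + 1)))
      (KInvStep (d := d) Lc j) x y a b) atTop (𝓝 L))
    (hBd : ∀ j, Decays (unitK ((Lc : ℝ) ^ j) ((Lc : ℝ) ^ (j * (d + 1))) (KTot (d := d) (Lc ^ (j + m)) (Lc ^ j))) CB δB)
    (hCb : ∀ j z w (a b : Fib d), |unitK ((Lc : ℝ) ^ j) ((Lc : ℝ) ^ (j * (d + 1))) (KInvStep (d := d) Lc j) z w a b| ≤ CS)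
    (G G' : Form1 (d + 1) ℝ) (hG : ∀ κ, (Function.support (G κ)).Finite) (hG' : ∀ κ, (Function.support (G' κ)).Finite)
    (hcoG : codiff₁ G = 0) (hcoG' : codiff₁ G' = 0) :
    (∑' x', ∑' y', ∑ κ, ∑ l, G κ x'
        * KPerf (d := d) Lc (fun j => (Lc : ℝ) ^ j) (fun j => (Lc : ℝ) ^ (j * (d + 1))) (m + 1) x' y' (Sum.inl κ) (Sum.inl l) * G' l y')
      = ∑' x', ∑' y', ∑ κ, ∑ l, G κ x' *
          (KPerf (d := d) Lc (fun j => (Lc : ℝ) ^ j) (fun j => (Lc : ℝ) ^ (j * (d + 1))) m x' y' (Sum.inl κ) (Sum.inl l)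
            - (((Lc : ℝ) ^ m) * ((Lc : ℝ) ^ m))⁻¹
              * comp (KPerf (d := d) Lc (fun j => (Lc : ℝ) ^ j) (fun j => (Lc : ℝ) ^ (j * (d + 1))) m)
                  (comp (liftW (Lc ^ m) true true (KPerf (d := d) Lc (fun j => (Lc : ℝ) ^ j) (fun j => (Lc : ℝ) ^ (j * (d + 1))) 1))
                    (KPerf (d := d) Lc (fun j => (Lc : ℝ) ^ j) (fun j => (Lc : ℝ) ^ (j * (d + 1))) m))
                  x' y' (Sum.inl κ) (Sum.inl l)) * G' l y' := by
  haveI : NeZero (Lc ^ m) := ⟨pow_ne_zero _ (NeZero.ne Lc)⟩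
  obtain ⟨s, hs⟩ := exists_support_finset G hG
  obtain ⟨s', hs'⟩ := exists_support_finset G' hG'
  -- names for the three rescaled families and their constructed limits
  set A : ℕ → MKer (d + 1) (Fib d) := fun j => unitK ((Lc : ℝ) ^ j) ((Lc : ℝ) ^ (j * (d + 1)))
    (KTot (d := d) (Lc ^ (j + m + 1)) (Lc ^ j)) with hA
  set B : ℕ → MKer (d + 1) (Fib d) := fun j => unitK ((Lc : ℝ) ^ j) ((Lc : ℝ) ^ (j * (d + 1)))
    (KTot (d := d) (Lc ^ (j + m)) (Lc ^ j)) with hB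
  set C : ℕ → MKer (d + 1) (Fib d) := fun j => unitK ((Lc : ℝ) ^ j) ((Lc : ℝ) ^ (j * (d + 1))) (KInvStep (d := d) Lc j) with hC
  have hKA : KPerf (d := d) Lc (fun j => (Lc : ℝ) ^ j) (fun j => (Lc : ℝ) ^ (j * (d + 1))) (m + 1) = limMKerOf A := rfl
  have hKB : KPerf (d := d) Lc (fun j => (Lc : ℝ) ^ j) (fun j => (Lc : ℝ) ^ (j * (d + 1))) m = limMKerOf B := rfl
  have hKC : KPerf (d := d) Lc (fun j => (Lc : ℝ) ^ j) (fun j => (Lc : ℝ) ^ (j * (d + 1))) 1 = limMKerOf C := by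
    rw [KPerf_one]
  have hKC' : limMKerOf (fun j => C (j + m)) = limMKerOf C := limMKerOf_add C m
  -- entrywise convergence to the constructed limits
  have tA : ∀ x y a b, Tendsto (fun j => A j x y a b) atTop (𝓝 (limMKerOf A x y a b)) :=
    fun x y a b => tendsto_limMKerOf_apply x y a b (hconvA x y a b)
  have tB : ∀ x y a b, Tendsto (fun j => B j x y a b) atTop (𝓝 (limMKerOf B x y a b)) :=
    fun x y a b => tendsto_limMKerOf_apply x y a b (hconvB x y a b)
  have tC : ∀ x y a b, Tendsto (fun j => C (j + m) x y a b) atTop (𝓝 (limMKerOf C x y a b)) := by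
    intro x y a b
    rw [← hKC']
    refine tendsto_limMKerOf_apply (K := fun j => C (j + m)) x y a b ?_
    obtain ⟨L, hL⟩ := hconvC x y a b
    exact ⟨L, hL.comp (tendsto_add_atTop_nat m)⟩
  -- the finite-level identity, as finite sums, for every `j`
  have hfin : ∀ j : ℕ, ∑ x' ∈ s, ∑ y' ∈ s', ∑ κ, ∑ l, G κ x' * A j x' y' (Sum.inl κ) (Sum.inl l) * G' l y'
      = ∑ x' ∈ s, ∑ y' ∈ s', ∑ κ, ∑ l, G κ x' * (B j x' y' (Sum.inl κ) (Sum.inl l)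
          - (((Lc : ℝ) ^ m) * ((Lc : ℝ) ^ m))⁻¹ * comp (B j) (comp (liftW (Lc ^ m) true true (C (j + m))) (B j)) x' y' (Sum.inl κ) (Sum.inl l))
          * G' l y' := by
    intro j
    have h := kTot_pair_telescoping_adopted (d := d) Lc hLc j m G G' hG hG' hcoG hcoG'
    rw [tsum_pair_eq_sum G G' s s' hs hs', tsum_pair_eq_sum G G' s s' hs hs'] at h
    exact h
  -- pass to the limit on both sides
  rw [hKA, hKB, hKC, tsum_pair_eq_sum G G' s s' hs hs', tsum_pair_eq_sum G G' s s' hs hs']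
  have limL : Tendsto (fun j => ∑ x' ∈ s, ∑ y' ∈ s', ∑ κ, ∑ l, G κ x' * A j x' y' (Sum.inl κ) (Sum.inl l) * G' l y') atTop
      (𝓝 (∑ x' ∈ s, ∑ y' ∈ s', ∑ κ, ∑ l, G κ x' * limMKerOf A x' y' (Sum.inl κ) (Sum.inl l) * G' l y')) :=
    tendsto_finsetSum _ fun x' _ => tendsto_finsetSum _ fun y' _ => tendsto_finsetSum _ fun κ _ =>
      tendsto_finsetSum _ fun l _ => ((tA _ _ _ _).const_mul _).mul_const _
  have limR : Tendsto (fun j => ∑ x' ∈ s, ∑ y' ∈ s', ∑ κ, ∑ l, G κ x' * (B j x' y' (Sum.inl κ) (Sum.inl l)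
          - (((Lc : ℝ) ^ m) * ((Lc : ℝ) ^ m))⁻¹ * comp (B j) (comp (liftW (Lc ^ m) true true (C (j + m))) (B j)) x' y' (Sum.inl κ) (Sum.inl l))
          * G' l y') atTop
      (𝓝 (∑ x' ∈ s, ∑ y' ∈ s', ∑ κ, ∑ l, G κ x' * (limMKerOf B x' y' (Sum.inl κ) (Sum.inl l)
          - (((Lc : ℝ) ^ m) * ((Lc : ℝ) ^ m))⁻¹
            * comp (limMKerOf B) (comp (liftW (Lc ^ m) true true (limMKerOf C)) (limMKerOf B)) x' y' (Sum.inl κ) (Sum.inl l)) * G' l y')) := by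
    refine tendsto_finsetSum _ fun x' _ => tendsto_finsetSum _ fun y' _ => tendsto_finsetSum _ fun κ _ =>
      tendsto_finsetSum _ fun l _ => (((tB _ _ _ _).sub ((tendsto_comp_liftW_comp (Lc ^ m) (B := B) (S := fun j => C (j + m))
        tB (fun z w μ ν => tC z w _ _) hBd hδB (fun j z w μ ν => hCb (j + m) z w _ _) x' y' κ l).const_mul _)).const_mul _).mul_const _
  exact tendsto_nhds_unique limL (by simpa only [hfin] using limR)

end Summit.QuantumFields.BalabanUV.Beta.FP.PerfectTelescopingLimit

end
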